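import Summits.ResolutionOfSingularities.ResolutionOfSingularities.Theses.MaxContactCut
import Summits.ResolutionOfSingularities.ResolutionOfSingularities.Theorems.ProximityCutArcLaw
import Summits.ResolutionOfSingularities.ResolutionOfSingularities.Theorems.MaxContactCutProximityCut

/-!
# MaxContactCutArcLaw — the node «ArcLaw» wired to the route MaxContactCut BY NAME
(lens-3 g24; kernel proof `ProximityCutArcLaw.noFreePointTails_holds` of the all-`e` arc law)

Closes BY NAME the two asides of the proximity cut: 33637 `MaxContactCut.PCArcLawPort`
(:= `ProximityCut.NoFreePointTails`) and 33636 `MaxContactCut.PCNoFreePointTailsDeep`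
(:= `ProximityCut.NoFreePointTailsDeep`).  With `MaxContactCutProximityCut.defectWalksDeep_iff_four` the located residual of
31770 `MaxContactCut.DefectWalksDeep` is now `NoBareTailsDeep ∧ SatDefectWalksTerminateDeep` (`defectWalksDeep_iff_two`).
0 sorry.  (Sources: Hauser2010 Lecture IX; CossartJannsenSaito2020 Cor. 5.37.)
-/

namespace Summit.ResolutionOfSingularities.ResolutionOfSingularities.Theorems.MaxContactCutArcLaw

open Summit.ResolutionOfSingularities.ResolutionOfSingularities.Theses
open Summit.ResolutionOfSingularities.ResolutionOfSingularities.Theorems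
open ProximityCut BoundaryLedger

/-- **Aside 33637 `PCArcLawPort` (the all-`e` ARC LAW) PROVED, by name.** [new] -/
theorem pcArcLawPort_holds : MaxContactCut.PCArcLawPort :=
  noFreePointTails_holds

/-- **Aside 33636 `PCNoFreePointTailsDeep` PROVED, by name.** [new] -/
theorem pcNoFreePointTailsDeep_holds : MaxContactCut.PCNoFreePointTailsDeep :=
  noFreePointTailsDeep_holds

/-- **The located residual of 31770 after the arc law (EXACT, by name):** `MaxContactCut.DefectWalksDeep` ⟺ g11's bare
line ∧ g11's satellite column. [new] -/
theorem defectWalksDeep_iff_two :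
    MaxContactCut.DefectWalksDeep ↔ NoBareTailsDeep ∧ SatDefectWalksTerminateDeep :=
  MaxContactCutProximityCut.defectWalksDeep_iff_four.trans
    ⟨fun h => h.2, fun h => ⟨noFreePointTailsDeep_holds, h⟩⟩

end Summit.ResolutionOfSingularities.ResolutionOfSingularities.Theorems.MaxContactCutArcLaw
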